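import Literature.NumberTheory.LFunctions.DirichletPolynomialMeanValue
import Literature.Analysis.Fourier.ExpAbsKernelPlancherel
import Mathlib.Analysis.SpecialFunctions.Integrals.Basic
import Mathlib.Analysis.SumIntegralComparisons
import HarnessLib

/-!
# The Lorentz-weighted mean value theorem for Dirichlet polynomials

Trunk T-ANT (`Literature/NumberTheory/LFunctions`). Everything here is PROVED; no definitions, no
named facts.

For a Dirichlet polynomial `A(t) = ∑_{n=1}^{N} a_n n^{-it}` and `T > 0`,

  `∫_ℝ |A(t)|² (1 + t²/T²)⁻¹ dt = π T ∑_{m,n} a_m ā_n e^{-T |log n − log m|}`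
  `                              = π T ∑_{m,n} a_m ā_n min(m/n, n/m)^T`

(`integral_lorentz_mul_norm_sq_dirichletPolynomial_eq`; the Lorentzian / Abel–Poisson Fourier pair
`∫ e^{iLx}(1+x²/T²)⁻¹ dx = πT e^{-T|L|}`, `integral_exp_mul_I_mul_lorentzian`, is read off the tree's
`Literature.Analysis.Fourier.exp_neg_mul_abs_eq_integral`), and hence, for `T ≥ 2`,

  `∫_ℝ |A(t)|² (1 + t²/T²)⁻¹ dt ≤ 3π ∑_{n=1}^{N} (T + n) |a_n|²`

(`dirichletPolynomial_lorentzMeanSquare_le`): Young's inequality `|a_m a_n| ≤ ½(|a_m|² + |a_n|²)`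
and the row sums `∑_m min(m/n,n/m)^T ≤ 1 + n/(T+1) + n/(T−1) ≤ 1 + 3n/T`
(`sum_exp_neg_mul_abs_log_sub_le`, sum–integral comparison on the two monotone branches). This is
the smoothed mean value theorem (5.15) of Conrey–Iwaniec (there with the weight `K̂`, here with
the Poisson weight), in the REFINED form `∑ (T + n)|a_n|²` (Montgomery–Vaughan shape) — the form in
which the tail of a Dirichlet polynomial longer than `T` costs `n/T` per coefficient; the tree's
unweighted `dirichletPolynomial_meanSquare_le` gives only `(5T + 18N) ∑ |a_n|²`.

## References

* J. B. Conrey, H. Iwaniec, *Spacing of zeros of Hecke L-functions and the class number problem*,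
  Acta Arith. 103 (2002), §5, (5.11)–(5.15). [ConreyIwaniec2002]
* H. L. Montgomery, R. C. Vaughan, *Hilbert's inequality*, J. London Math. Soc. (2) 8 (1974),
  Cor. 3 (the sharp `∑ (T + O(n)) |a_n|²`; not needed here).
* L. Grafakos, *Classical Fourier Analysis*, 3rd ed., Exercise 2.2.11 (b) (Poisson-kernel pair).
  [Grafakos2014]
-/

noncomputable section

open Finset Real MeasureTheory Complex
open scoped ComplexConjugate

namespace Literature.NumberTheory.LFunctions

/-! ### The Lorentzian Fourier pair -/

/-- **Fourier transform of the Lorentzian** at a real frequency `L` (`T > 0`):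
`∫_ℝ e^{iLx} (1 + x²/T²)⁻¹ dx = π T e^{-T|L|}` — the Abel–Poisson pair
`e^{-T|L|} = (1/2π) ∫ (2T/(T²+x²)) e^{ixL} dx` of the tree
(`Literature.Analysis.Fourier.exp_neg_mul_abs_eq_integral`) with `(1+x²/T²)⁻¹ = (T/2)·2T/(T²+x²)`.
[cite: Grafakos2014, Exercise 2.2.11 (b) (n = 1; the Poisson-kernel pair, dilated), PDF p. 133] -/
theorem integral_exp_mul_I_mul_lorentzian {T : ℝ} (hT : 0 < T) (L : ℝ) :
    ∫ x : ℝ, Complex.exp ((L : ℂ) * x * I) * (((1 + x ^ 2 / T ^ 2)⁻¹ : ℝ) : ℂ) =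
      ((π * T * Real.exp (-(T * |L|)) : ℝ) : ℂ) := by
  have h := Literature.Analysis.Fourier.exp_neg_mul_abs_eq_integral hT L
  set X : ℂ := ∫ z : ℝ, ((2 * T / (T ^ 2 + z ^ 2) : ℝ) : ℂ) * cexp (I * z * L) with hX
  have hpt : ∀ x : ℝ, Complex.exp ((L : ℂ) * x * I) * (((1 + x ^ 2 / T ^ 2)⁻¹ : ℝ) : ℂ) =
      ((T / 2 : ℝ) : ℂ) * ((((2 * T / (T ^ 2 + x ^ 2)) : ℝ) : ℂ) * cexp (I * x * L)) := by
    intro x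
    have hTx : 0 < T ^ 2 + x ^ 2 := by positivity
    have hx : (1 + x ^ 2 / T ^ 2)⁻¹ = T / 2 * (2 * T / (T ^ 2 + x ^ 2)) := by
      field_simp
    have he : Complex.exp ((L : ℂ) * x * I) = cexp (I * x * L) := by ring_nf
    rw [hx, he, Complex.ofReal_mul]
    ring
  simp_rw [hpt]
  rw [integral_const_mul]
  have e1 : ((2 * π : ℝ) : ℂ) * (((1 / (2 * π) : ℝ) : ℂ)) = 1 := by
    rw [← Complex.ofReal_mul, show (2 * π) * (1 / (2 * π)) = (1 : ℝ) by field_simp]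
    simp
  have hX' : X = ((2 * π * Real.exp (-(T * |L|)) : ℝ) : ℂ) := by
    calc X = ((2 * π : ℝ) : ℂ) * (((1 / (2 * π) : ℝ) : ℂ) * X) := by
          rw [← mul_assoc, e1, one_mul]
      _ = ((2 * π : ℝ) : ℂ) * (Real.exp (-(T * |L|)) : ℂ) := by rw [← h]
      _ = ((2 * π * Real.exp (-(T * |L|)) : ℝ) : ℂ) := by push_cast; ring
  rw [← hX, hX']
  push_cast
  ring

/-- The Lorentzian weight `(1 + t²/T²)⁻¹` is integrable on `ℝ` (`T > 0`; a dilated Poisson kernel).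
[cite: Grafakos2014, Example 1.2.16 (the Poisson kernel P(x) = (π(x²+1))⁻¹ is in L¹), PDF p. 49] -/
theorem integrable_lorentzian {T : ℝ} (hT : 0 < T) :
    Integrable fun t : ℝ => (1 + t ^ 2 / T ^ 2)⁻¹ := by
  have h := (Literature.Analysis.Fourier.integrable_cauchyMultiplier hT (one_ne_zero)).const_mul
    (T / 2)
  refine h.congr (Filter.Eventually.of_forall fun t => ?_)
  have hTt : 0 < T ^ 2 + (1 * t) ^ 2 := by positivity
  simp only [one_mul] at hTt ⊢
  field_simp

/-- The Lorentzian weight `(1 + t²/T²)⁻¹` is continuous (`T > 0`).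
[cite: Grafakos2014, Example 1.2.16 (the Poisson kernel), PDF p. 49] -/
theorem continuous_lorentzian (T : ℝ) (hT : 0 < T) :
    Continuous fun t : ℝ => (1 + t ^ 2 / T ^ 2)⁻¹ := by
  refine Continuous.inv₀ (by fun_prop) fun t => ?_
  positivity

/-! ### The Dirichlet polynomial as a function of `t` -/

/-- The Dirichlet polynomial `t ↦ A(it) = ∑_{n=1}^{N} a_n n^{-it}` of (5.11) is continuous in `t`.
[cite: ConreyIwaniec2002, §5, (5.11)] -/
theorem continuous_dirichletPolynomial (a : ℕ → ℂ) (N : ℕ) :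
    Continuous fun t : ℝ => ∑ n ∈ Finset.Icc 1 N, a n * (n : ℂ) ^ (-((t : ℂ) * I)) := by
  have h : (fun t : ℝ => ∑ n ∈ Finset.Icc 1 N, a n * (n : ℂ) ^ (-((t : ℂ) * I))) =
      fun t : ℝ => ∑ n ∈ Finset.Icc 1 N,
        a n * Complex.exp ((-(t * Real.log n) : ℝ) * I) := by
    funext t
    refine Finset.sum_congr rfl fun n hn => ?_
    rw [Finset.mem_Icc] at hn
    rw [natCast_cpow_neg_mul_I (by omega)]
  rw [h]
  refine continuous_finsetSum _ fun n _ => continuous_const.mul ?_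
  fun_prop

/-- The Dirichlet polynomial of (5.11) is bounded: `|∑_{n=1}^{N} a_n n^{-it}| ≤ ∑ |a_n|`.
[cite: ConreyIwaniec2002, §5, (5.11)] -/
theorem norm_dirichletPolynomial_le (a : ℕ → ℂ) (N : ℕ) (t : ℝ) :
    ‖∑ n ∈ Finset.Icc 1 N, a n * (n : ℂ) ^ (-((t : ℂ) * I))‖ ≤ ∑ n ∈ Finset.Icc 1 N, ‖a n‖ := by
  refine (norm_sum_le _ _).trans (le_of_eq (Finset.sum_congr rfl fun n hn => ?_))
  rw [Finset.mem_Icc] at hn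
  rw [norm_mul, natCast_cpow_neg_mul_I (by omega), Complex.norm_exp_ofReal_mul_I, mul_one]

/-- For an integrable weight `w` the smoothed mean square integrand
`t ↦ w(t) |∑_{n=1}^{N} a_n n^{-it}|²` of (5.12) is integrable (the Dirichlet polynomial is continuous
and bounded by `∑ |a_n|`). [cite: ConreyIwaniec2002, §5, (5.12)] -/
theorem integrable_mul_norm_sq_dirichletPolynomial (a : ℕ → ℂ) (N : ℕ) {w : ℝ → ℝ}
    (hw : Integrable w) :
    Integrable fun t : ℝ =>
      w t * ‖∑ n ∈ Finset.Icc 1 N, a n * (n : ℂ) ^ (-((t : ℂ) * I))‖ ^ 2 := by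
  set A : ℝ := ∑ n ∈ Finset.Icc 1 N, ‖a n‖ with hA
  have h : Integrable fun t : ℝ =>
      ‖∑ n ∈ Finset.Icc 1 N, a n * (n : ℂ) ^ (-((t : ℂ) * I))‖ ^ 2 * w t := by
    refine hw.bdd_mul (c := A ^ 2) ?_ ?_
    · exact ((continuous_norm.comp (continuous_dirichletPolynomial a N)).pow 2).aestronglyMeasurable
    · refine Filter.Eventually.of_forall fun t => ?_
      rw [Real.norm_of_nonneg (by positivity)]
      have h0 : 0 ≤ A := Finset.sum_nonneg fun n _ => norm_nonneg _
      exact pow_le_pow_left₀ (norm_nonneg _) (norm_dirichletPolynomial_le a N t) 2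
  exact h.congr (Filter.Eventually.of_forall fun t => by ring)

/-! ### The exact formula -/

/-- **The Lorentz-weighted mean square, exactly**: for `T > 0`,
`∫_ℝ (1+t²/T²)⁻¹ |∑_{n=1}^{N} a_n n^{-it}|² dt = ∑_{m,n=1}^{N} a_m ā_n · πT e^{-T|log n − log m|}`
(expand the square and integrate each oscillating term against the Lorentzian with
`integral_exp_mul_I_mul_lorentzian`; `e^{-T|log n − log m|} = min(m/n, n/m)^T`).
[cite: ConreyIwaniec2002, §5, proof of Proposition 5.4, display before (5.15)] -/
theorem integral_lorentz_mul_norm_sq_dirichletPolynomial_eq (a : ℕ → ℂ) (N : ℕ) {T : ℝ}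
    (hT : 0 < T) :
    (((∫ t : ℝ, (1 + t ^ 2 / T ^ 2)⁻¹ *
        ‖∑ n ∈ Finset.Icc 1 N, a n * (n : ℂ) ^ (-((t : ℂ) * I))‖ ^ 2 : ℝ) : ℂ)) =
      ∑ m ∈ Finset.Icc 1 N, ∑ n ∈ Finset.Icc 1 N,
        a m * conj (a n) *
          ((π * T * Real.exp (-(T * |Real.log n - Real.log m|)) : ℝ) : ℂ) := by
  -- the phases as exponentials
  set e : ℕ → ℝ → ℂ := fun n t => Complex.exp ((-(t * Real.log n) : ℝ) * I) with he
  set D : ℝ → ℂ := fun t => ∑ n ∈ Finset.Icc 1 N, a n * e n t with hD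
  have hDe : ∀ t : ℝ, ∑ n ∈ Finset.Icc 1 N, a n * (n : ℂ) ^ (-((t : ℂ) * I)) = D t := by
    intro t
    refine Finset.sum_congr rfl fun n hn => ?_
    rw [Finset.mem_Icc] at hn
    rw [natCast_cpow_neg_mul_I (by omega)]
  simp_rw [hDe]
  have hγint : Integrable fun t : ℝ => (1 + t ^ 2 / T ^ 2)⁻¹ := integrable_lorentzian hT
  have integrable_term : ∀ L : ℝ, ∀ c : ℂ,
      Integrable fun x : ℝ => c * (Complex.exp ((L : ℂ) * x * I) *
        (((1 + x ^ 2 / T ^ 2)⁻¹ : ℝ) : ℂ)) := by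
    intro L c
    refine Integrable.const_mul ?_ _
    refine hγint.ofReal.bdd_mul (c := 1) ?_ ?_
    · exact (Continuous.cexp (by fun_prop)).aestronglyMeasurable
    · refine Filter.Eventually.of_forall fun x => le_of_eq ?_
      rw [show (L : ℂ) * x * I = ((L * x : ℝ) : ℂ) * I by push_cast; ring]
      exact Complex.norm_exp_ofReal_mul_I _
  rw [← integral_complex_ofReal]
  have hpt : ∀ t : ℝ, (((1 + t ^ 2 / T ^ 2)⁻¹ * ‖D t‖ ^ 2 : ℝ) : ℂ) =
      ∑ m ∈ Finset.Icc 1 N, ∑ n ∈ Finset.Icc 1 N,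
        a m * conj (a n) *
          (Complex.exp (((Real.log n - Real.log m : ℝ) : ℂ) * t * I) *
            (((1 + t ^ 2 / T ^ 2)⁻¹ : ℝ) : ℂ)) := by
    intro t
    rw [Complex.ofReal_mul, ofReal_norm_sq_sum_eq, Finset.mul_sum]
    refine Finset.sum_congr rfl fun m _ => ?_
    rw [Finset.mul_sum]
    refine Finset.sum_congr rfl fun n _ => ?_
    simp only [he, map_mul, conj_exp_ofReal_mul_I]
    have : Complex.exp (((-(t * Real.log m)) : ℝ) * I) *
        Complex.exp (((-(-(t * Real.log n))) : ℝ) * I)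
        = Complex.exp (((Real.log n - Real.log m : ℝ) : ℂ) * t * I) := by
      rw [← Complex.exp_add]
      congr 1
      push_cast
      ring
    calc (((1 + t ^ 2 / T ^ 2)⁻¹ : ℝ) : ℂ) * (a m * Complex.exp (((-(t * Real.log m)) : ℝ) * I) *
          (conj (a n) * Complex.exp (((-(-(t * Real.log n))) : ℝ) * I)))
        = a m * conj (a n) * ((Complex.exp (((-(t * Real.log m)) : ℝ) * I) *
            Complex.exp (((-(-(t * Real.log n))) : ℝ) * I)) *
              (((1 + t ^ 2 / T ^ 2)⁻¹ : ℝ) : ℂ)) := by ring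
      _ = _ := by rw [this]
  simp_rw [hpt]
  rw [integral_finsetSum]
  · refine Finset.sum_congr rfl fun m _ => ?_
    rw [integral_finsetSum]
    · refine Finset.sum_congr rfl fun n _ => ?_
      rw [integral_const_mul]
      congr 1
      exact integral_exp_mul_I_mul_lorentzian hT (Real.log n - Real.log m)
    · intro n _
      exact integrable_term _ _
  · intro m _
    exact integrable_finsetSum _ fun n _ => integrable_term _ _

/-! ### Row sums of the kernel `e^{-T|log n − log m|} = min(m/n, n/m)^T` -/

/-- Lower branch: `∑_{m=1}^{n} (m/n)^T ≤ 1 + n/(T+1)` for `T > 0`, `n ≥ 1`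
(the terms `m < n` against `∫_0^n (x/n)^T dx = n/(T+1)`). [folklore] -/
private theorem sum_div_rpow_le {T : ℝ} (hT : 0 < T) {n : ℕ} (hn : 1 ≤ n) :
    ∑ m ∈ Finset.Icc 1 n, ((m : ℝ) / n) ^ T ≤ 1 + n / (T + 1) := by
  have hn0 : (0 : ℝ) < n := by exact_mod_cast hn
  set f : ℝ → ℝ := fun x => (x / n) ^ T with hf
  have hf0 : ∀ m : ℕ, 0 ≤ f m := fun m => by positivity
  have hmono : MonotoneOn f (Set.Icc ((0 : ℕ) : ℝ) (n : ℕ)) := by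
    intro x hx y _ hxy
    simp only [Nat.cast_zero, Set.mem_Icc] at hx
    obtain ⟨hx0, _⟩ := hx
    exact Real.rpow_le_rpow (div_nonneg hx0 hn0.le)
      (div_le_div_of_nonneg_right hxy hn0.le) hT.le
  have h1 := MonotoneOn.sum_le_integral_Ico (Nat.zero_le n) hmono
  -- `∫_0^n (x/n)^T dx = n/(T+1)`
  have hint : ∫ x in ((0 : ℕ) : ℝ)..((n : ℕ) : ℝ), f x = n / (T + 1) := by
    simp only [Nat.cast_zero, hf]
    rw [intervalIntegral.integral_comp_div (fun x : ℝ => x ^ T) hn0.ne', zero_div, div_self hn0.ne',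
      integral_rpow (Or.inl (by linarith)), Real.one_rpow, Real.zero_rpow (by linarith),
      sub_zero, smul_eq_mul]
    ring
  -- `∑_{Icc 1 n} f ≤ ∑_{Ico 0 n} f + f n`
  have hsub : Finset.Icc 1 n ⊆ Finset.Ico 0 (n + 1) := by
    intro m hm
    simp only [Finset.mem_Icc, Finset.mem_Ico] at hm ⊢
    omega
  have hfn : f n = 1 := by simp only [hf, div_self hn0.ne', Real.one_rpow]
  calc ∑ m ∈ Finset.Icc 1 n, f m ≤ ∑ m ∈ Finset.Ico 0 (n + 1), f m :=
        Finset.sum_le_sum_of_subset_of_nonneg hsub fun m _ _ => hf0 m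
    _ = ∑ m ∈ Finset.Ico 0 n, f m + f n := Finset.sum_Ico_succ_top (Nat.zero_le n) _
    _ ≤ n / (T + 1) + 1 := by rw [hfn, ← hint]; exact add_le_add h1 le_rfl
    _ = 1 + n / (T + 1) := by ring

/-- Upper branch: `∑_{m=n+1}^{N} (n/m)^T ≤ n/(T−1)` for `T > 1`, `n ≥ 1`
(against `∫_n^N (n/x)^T dx = n^T (n^{1−T} − N^{1−T})/(T−1)`). [folklore] -/
private theorem sum_div_rpow_le' {T : ℝ} (hT : 1 < T) {n N : ℕ} (hn : 1 ≤ n) (hnN : n ≤ N) :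
    ∑ m ∈ Finset.Icc (n + 1) N, ((n : ℝ) / m) ^ T ≤ n / (T - 1) := by
  have hn0 : (0 : ℝ) < n := by exact_mod_cast hn
  have hN0 : (0 : ℝ) < N := by exact_mod_cast (lt_of_lt_of_le (by omega) hnN : 0 < N)
  set g : ℝ → ℝ := fun x => (n / x) ^ T with hg
  have hanti : AntitoneOn g (Set.Icc ((n : ℕ) : ℝ) (N : ℕ)) := by
    intro x hx y hy hxy
    simp only [Set.mem_Icc] at hx hy
    have hx0 : 0 < x := lt_of_lt_of_le hn0 hx.1
    simp only [hg]
    exact Real.rpow_le_rpow (div_nonneg hn0.le (hn0.le.trans hy.1))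
      (div_le_div_of_nonneg_left hn0.le hx0 hxy) (by linarith)
  have h1 := AntitoneOn.sum_le_integral_Ico hnN hanti
  -- reindex: `∑_{i ∈ Ico n N} g (i+1) = ∑_{m ∈ Icc (n+1) N} g m`
  have hre : ∑ i ∈ Finset.Ico n N, g ((i + 1 : ℕ) : ℝ) = ∑ m ∈ Finset.Icc (n + 1) N, g m := by
    rw [Finset.sum_Ico_add' (fun i : ℕ => g (i : ℝ)) n N 1, Finset.Ico_add_one_right_eq_Icc]
  -- the integral
  have hint : ∫ x in ((n : ℕ) : ℝ)..((N : ℕ) : ℝ), g x ≤ n / (T - 1) := by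
    have hsub : Set.uIcc (n : ℝ) N = Set.Icc (n : ℝ) N := Set.uIcc_of_le (by exact_mod_cast hnN)
    have h0 : (0 : ℝ) ∉ Set.uIcc (n : ℝ) N := by
      rw [hsub]; intro h; exact absurd h.1 (not_le.mpr hn0)
    have hcongr : ∫ x in (n : ℝ)..N, g x = ∫ x in (n : ℝ)..N, (n : ℝ) ^ T * x ^ (-T) := by
      refine intervalIntegral.integral_congr fun x hx => ?_
      rw [hsub] at hx
      have hx0 : 0 < x := lt_of_lt_of_le hn0 hx.1
      simp only [hg]
      rw [Real.div_rpow hn0.le hx0.le, Real.rpow_neg hx0.le, div_eq_mul_inv]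
    rw [hcongr, intervalIntegral.integral_const_mul,
      integral_rpow (Or.inr ⟨by linarith, h0⟩)]
    have hT1 : -T + 1 ≠ 0 := by linarith
    have hT1' : T - 1 ≠ 0 := by linarith
    have hnn : (n : ℝ) ^ T * (n : ℝ) ^ (-T + 1) = n := by
      rw [← Real.rpow_add hn0, show T + (-T + 1) = 1 by ring, Real.rpow_one]
    set u : ℝ := (N : ℝ) ^ (-T + 1) with hu
    have hNpos : 0 ≤ (n : ℝ) ^ T * u := by positivity
    have key : (n : ℝ) ^ T * ((u - (n : ℝ) ^ (-T + 1)) / (-T + 1)) =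
        ((n : ℝ) ^ T * (n : ℝ) ^ (-T + 1) - (n : ℝ) ^ T * u) / (T - 1) := by
      rw [mul_div_assoc', div_eq_div_iff hT1 hT1']
      ring
    rw [key, hnn]
    exact div_le_div_of_nonneg_right (by linarith) (by linarith)
  calc ∑ m ∈ Finset.Icc (n + 1) N, ((n : ℝ) / m) ^ T
      = ∑ i ∈ Finset.Ico n N, g ((i + 1 : ℕ) : ℝ) := hre.symm
    _ ≤ ∫ x in ((n : ℕ) : ℝ)..((N : ℕ) : ℝ), g x := h1
    _ ≤ n / (T - 1) := hint

/-- **Row sums of the Poisson kernel in `log`**: for `1 ≤ n ≤ N` and `T ≥ 2`,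
`∑_{m=1}^{N} e^{-T |log n − log m|} = ∑_m min(m/n, n/m)^T ≤ 1 + 3n/T`
(`≤ 1 + n/(T+1) + n/(T−1)` from the two monotone branches) — the row-sum bound behind the printed
`πT ∑∑ a_m ā_n (m/n)^{±T} ≤ 3πTG` of (5.15). [cite: ConreyIwaniec2002, §5, (5.15)] -/
theorem sum_exp_neg_mul_abs_log_sub_le {T : ℝ} (hT : 2 ≤ T) {N n : ℕ} (hn : n ∈ Finset.Icc 1 N) :
    ∑ m ∈ Finset.Icc 1 N, Real.exp (-(T * |Real.log n - Real.log m|)) ≤ 1 + 3 * n / T := by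
  rw [Finset.mem_Icc] at hn
  have hn0 : (0 : ℝ) < n := by exact_mod_cast hn.1
  have hT0 : 0 < T := by linarith
  -- the kernel on the two branches
  have hlow : ∀ m ∈ Finset.Icc 1 n,
      Real.exp (-(T * |Real.log n - Real.log m|)) = ((m : ℝ) / n) ^ T := by
    intro m hm
    rw [Finset.mem_Icc] at hm
    have hm0 : (0 : ℝ) < m := by exact_mod_cast hm.1
    have hmn : (m : ℝ) ≤ n := by exact_mod_cast hm.2
    rw [abs_of_nonneg (by linarith [Real.log_le_log hm0 hmn]),
      Real.rpow_def_of_pos (by positivity), Real.log_div hm0.ne' hn0.ne']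
    congr 1; ring
  have hupp : ∀ m ∈ Finset.Icc (n + 1) N,
      Real.exp (-(T * |Real.log n - Real.log m|)) = ((n : ℝ) / m) ^ T := by
    intro m hm
    rw [Finset.mem_Icc] at hm
    have hm0 : (0 : ℝ) < m := by exact_mod_cast (by omega : 0 < m)
    have hmn : (n : ℝ) ≤ m := by exact_mod_cast (by omega : n ≤ m)
    rw [abs_of_nonpos (by linarith [Real.log_le_log hn0 hmn]),
      Real.rpow_def_of_pos (by positivity), Real.log_div hn0.ne' hm0.ne']
    congr 1; ring
  -- split the range
  have hsplit : Finset.Icc 1 N = Finset.Icc 1 n ∪ Finset.Icc (n + 1) N := by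
    ext m; simp only [Finset.mem_union, Finset.mem_Icc]; omega
  have hdisj : Disjoint (Finset.Icc 1 n) (Finset.Icc (n + 1) N) := by
    rw [Finset.disjoint_left]; intro m hm hm'
    simp only [Finset.mem_Icc] at hm hm'; omega
  rw [hsplit, Finset.sum_union hdisj, Finset.sum_congr rfl hlow, Finset.sum_congr rfl hupp]
  have h1 := sum_div_rpow_le hT0 hn.1
  have h2 := sum_div_rpow_le' (by linarith : (1 : ℝ) < T) hn.1 hn.2
  -- `n/(T+1) + n/(T-1) ≤ 3n/T` for `T ≥ 2`
  have h3 : (n : ℝ) / (T + 1) ≤ n / T := div_le_div_of_nonneg_left hn0.le hT0 (by linarith)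
  have h4 : (n : ℝ) / (T - 1) ≤ 2 * n / T := by
    rw [div_le_div_iff₀ (by linarith) hT0]
    nlinarith
  have : 1 + (n : ℝ) / (T + 1) + n / (T - 1) ≤ 1 + 3 * n / T := by
    have e : (3 : ℝ) * n / T = n / T + 2 * n / T := by ring
    rw [e]; linarith
  linarith

/-! ### The Lorentz-weighted mean value theorem -/

/-- **The Lorentz-weighted mean value theorem for Dirichlet polynomials** (PROVED; the smoothed
mean value theorem of Conrey–Iwaniec (5.15) with the Poisson weight, in Montgomery–Vaughan's
refined shape): for complex `a_n`, `N ∈ ℕ` and `T ≥ 2`,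
`∫_ℝ (1 + t²/T²)⁻¹ |∑_{n=1}^{N} a_n n^{-it}|² dt ≤ 3π ∑_{n=1}^{N} (T + n) |a_n|²`.
Proof: the exact formula `integral_lorentz_mul_norm_sq_dirichletPolynomial_eq`, Young's inequality
with symmetry (`sum_sum_mul_mul_le_of_symm`) and the row sums
`∑_m e^{-T|log n − log m|} ≤ 1 + 3n/T` (`sum_exp_neg_mul_abs_log_sub_le`):
`πT ∑_n |a_n|² (1 + 3n/T) = π ∑ (T + 3n)|a_n|²`.
[cite: ConreyIwaniec2002, §5, (5.15)] -/
theorem dirichletPolynomial_lorentzMeanSquare_le (a : ℕ → ℂ) (N : ℕ) {T : ℝ} (hT : 2 ≤ T) :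
    ∫ t : ℝ, (1 + t ^ 2 / T ^ 2)⁻¹ *
        ‖∑ n ∈ Finset.Icc 1 N, a n * (n : ℂ) ^ (-((t : ℂ) * I))‖ ^ 2 ≤
      3 * π * ∑ n ∈ Finset.Icc 1 N, (T + n) * ‖a n‖ ^ 2 := by
  have hT0 : 0 < T := by linarith
  set E : ℕ → ℕ → ℝ := fun m n => Real.exp (-(T * |Real.log n - Real.log m|)) with hE
  have hE0 : ∀ m n, 0 ≤ E m n := fun m n => (Real.exp_pos _).le
  have hEsymm : ∀ m n, E m n = E n m := by
    intro m n; simp only [hE, abs_sub_comm]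
  set J : ℝ := ∫ t : ℝ, (1 + t ^ 2 / T ^ 2)⁻¹ *
      ‖∑ n ∈ Finset.Icc 1 N, a n * (n : ℂ) ^ (-((t : ℂ) * I))‖ ^ 2 with hJ
  have step3 : ((J : ℝ) : ℂ) = ∑ m ∈ Finset.Icc 1 N, ∑ n ∈ Finset.Icc 1 N,
      a m * conj (a n) * ((π * T * E m n : ℝ) : ℂ) :=
    integral_lorentz_mul_norm_sq_dirichletPolynomial_eq a N hT0
  -- bound the double sum by norms
  have step4 : J ≤ π * T * ∑ m ∈ Finset.Icc 1 N, ∑ n ∈ Finset.Icc 1 N, ‖a m‖ * ‖a n‖ * E m n := by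
    have hre : J = ((J : ℝ) : ℂ).re := by simp
    rw [hre, step3]
    refine (Complex.re_le_norm _).trans ?_
    refine (norm_sum_le _ _).trans ?_
    rw [Finset.mul_sum]
    refine Finset.sum_le_sum fun m _ => ?_
    refine (norm_sum_le _ _).trans ?_
    rw [Finset.mul_sum]
    refine Finset.sum_le_sum fun n _ => le_of_eq ?_
    rw [norm_mul, norm_mul, Complex.norm_conj, Complex.norm_real, Real.norm_of_nonneg
      (by positivity : (0 : ℝ) ≤ π * T * E m n)]
    ring
  -- Young's inequality, symmetry, and the row sums
  have step5 : ∑ m ∈ Finset.Icc 1 N, ∑ n ∈ Finset.Icc 1 N, ‖a m‖ * ‖a n‖ * E m n ≤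
      ∑ n ∈ Finset.Icc 1 N, ‖a n‖ ^ 2 * (1 + 3 * n / T) := by
    refine (sum_sum_mul_mul_le_of_symm _ (fun n => ‖a n‖) E hEsymm hE0).trans ?_
    refine Finset.sum_le_sum fun n hn => ?_
    exact mul_le_mul_of_nonneg_left (sum_exp_neg_mul_abs_log_sub_le hT hn) (sq_nonneg _)
  calc J ≤ π * T * ∑ m ∈ Finset.Icc 1 N, ∑ n ∈ Finset.Icc 1 N, ‖a m‖ * ‖a n‖ * E m n := step4
    _ ≤ π * T * ∑ n ∈ Finset.Icc 1 N, ‖a n‖ ^ 2 * (1 + 3 * n / T) := by gcongr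
    _ = π * ∑ n ∈ Finset.Icc 1 N, (T + 3 * n) * ‖a n‖ ^ 2 := by
        have hTne : T ≠ 0 := hT0.ne'
        simp only [Finset.mul_sum, mul_assoc]
        refine Finset.sum_congr rfl fun n _ => ?_
        field_simp
    _ ≤ π * (3 * ∑ n ∈ Finset.Icc 1 N, (T + n) * ‖a n‖ ^ 2) := by
        refine mul_le_mul_of_nonneg_left ?_ pi_pos.le
        rw [Finset.mul_sum]
        refine Finset.sum_le_sum fun n _ => ?_
        have hn0 : (0 : ℝ) ≤ n := Nat.cast_nonneg n
        nlinarith [sq_nonneg ‖a n‖, hT0.le, hn0]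
    _ = 3 * π * ∑ n ∈ Finset.Icc 1 N, (T + n) * ‖a n‖ ^ 2 := by ring


end Literature.NumberTheory.LFunctions
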